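import Mathlib
import HarnessLib
import Literature.Analysis.FluidPDE.Tao2016AveragedNS.LocalCascadeSolutions
import Literature.Analysis.FluidPDE.Tao2016AveragedNS.RenormalisedCascadeWaves
import Literature.Analysis.FluidPDE.Tao2016AveragedNS.SelfSimilarCascadeBlowup
import Literature.Analysis.FluidPDE.Tao2016AveragedNS.ViscousEternalSolutions
import Literature.Analysis.FluidPDE.Tao2016AveragedNS.BoundedEternalSolutions
import Summits.NavierStokesRegularity.NavierStokesRegularity.Theses.TaoLadderRungTwoBreak
import Summits.NavierStokesRegularity.NavierStokesRegularity.Theorems.TransitMassLedgerActionTransitExtractionSmallAmplitudeRung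

/-!
# BC5 WITNESS RUNG for the DECIDING crux K1ᵛ(1) `TaoLadderRungTwoBreak.NoSurvivingEternalViscBddOne`
# (stmt-NavierStokesRegularity-20419) — the SMALL-AMPLITUDE LIOUVILLE THEOREM WITH COVARIANT VISCOSITY:
# a uniformly SMALL admissible eternal solution of the renormalised lattice, with ANY covariant viscosity
# `ν̂ ≥ 0`, is zero

MODEL lattice ODEs only (Tao 2016 §4 in the self-similar log-time variables of §6.4); nothing in this file
is a statement about the Navier–Stokes equations, and no summit or rung LEAF is proved by it
(`--supports stmt-NavierStokesRegularity-20419 --as helper`).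

The tree's `…ActionTransitExtraction.SmallAmplitudeRung.eq_zero_of_small` (TransitMassLedger lane) is the
INVISCID small-amplitude Liouville theorem: it fences the VECTOR `e^{s} W_k(s)`, whose derivative `e^{s} q_k` is
quadratically small.  With covariant viscosity the shell law carries the extra term
`-ν̂ (1+ε₀)^{2k} e^{-σ} W_k`, UNBOUNDED in `k` and as `σ → -∞`, so that fencing fails.  Here the ENERGY form is
fenced instead: `φ_k(s) = e^{2s} ‖W_k(s)‖²` has `φ_k' = 2 e^{2s}(⟪W_k, q_k⟫ − visc·‖W_k‖²) ≤ 2 e^{2s} K D³`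
(`hasDerivAt_expSq`, `deriv_expSq_le`; the dissipation has a SIGN and is dropped, the damping `-W_k` is
absorbed by the weight, `‖q_k‖ ≤ K D²` is the tree's `norm_quadPart_le` with the quadratic constant
`K = quadConst ε₀ α`).  Hence `φ_k(σ) − K D³ e^{2σ}` is antitone, and letting the base point go to `-∞`
(ETERNITY + the uniform bound: `φ_k(a) ≤ e^{2a} D² → 0`) gives the squaring step in energy form
`‖W_k(σ)‖² ≤ K D³` (`norm_sq_le_of_bound`).  From `sup ‖W‖ ≤ δ` with `K δ < 1` the bounds
`‖W‖ ≤ (Kδ)^{j/2} δ` follow by induction (`r = √(Kδ) < 1`), so `W ≡ 0` (`eq_zero_of_small_visc`) — for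
every `ε₀ > 0`, every table of any size (no cancellation, no comparability, no admissibility clause used)
and every `ν̂ ≥ 0`; contrapositive = the AMPLITUDE QUANTUM `sup ‖W‖ ≥ 1/K` for non-zero bounded viscous
eternal solutions (`exists_norm_gt_of_ne_zero_visc`).

THE RUNG (`noSurvivingEternalViscBddOne_smallAmplitude`, PROVED, threshold `εs = 1`, uniform in `R`; it IS
a case of the crux: `smallAmplitude_of_noSurvivingEternalViscBddOne`): below `ε₀ ≤ 1`, no E₂(R) table carries
an admissible eternal solution with covariant viscosity `ν̂ ≥ 0` of sup-norm `≤ 1/1000` that is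
(S₁)-surviving forward (`quadConst ≤ 704` on E₂(R), tree `quadConst_le`).  It covers BOTH split children at
once on that slice ((ρ0) `ν̂ = 0` — the tree's inviscid rung — and (ρ+) `ν̂ > 0`, new).

HONEST CLAUSE: a witness of weakness, uniform in `ε₀ ∈ (0,1]` but not exercising `ε₀ → 0`; the objects
K1ᵛ(1) must exclude (loud ladders, surviving fronts) live at amplitude `≥ 1/K`; ⟨20419⟩, ⟨20451⟩, ⟨20452⟩
stay OPEN.  Lattice analogue of «small bounded ancient solutions of a critically damped quadratic evolution
are trivial» (small-data half of Koch–Nadirashvili–Seregin–Šverák-type Liouville theorems).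
-/

noncomputable section

-- the summit and its single sub-problem share the name (CONVENTIONS §1)
set_option linter.dupNamespace false

namespace Summit.NavierStokesRegularity.NavierStokesRegularity.Theorems.NoSurvivingEternalViscBddOne.SmallAmplitude

open Set Filter Topology
open scoped RealInnerProductSpace
open Literature.Analysis.FluidPDE Literature.Analysis.FluidPDE.TaoCascade
open Summit.NavierStokesRegularity.NavierStokesRegularity.Cruxes.ActionTransitExtraction.SmallAmplitudeRung
  (quadConst quadPart quadConst_nonneg norm_quadPart_le quadConst_le not_survivingFwd_of_eq_zero)
open Summit.NavierStokesRegularity.NavierStokesRegularity.Theses.TaoLadderRungTwoBreak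

variable {m : ℕ} {ε₀ νh : ℝ} {α : Fin m → Fin m → Fin m → ℤ × ℤ × ℤ → ℝ} {W : ℤ → ℝ → Em m}

/-! ## The energy form of one shell and its one-sided derivative bound -/

/-- The weighted shell energy `φ_k(x) = e^{2x}‖W_k(x)‖²` of an admissible viscous eternal solution is
differentiable with `φ_k' = 2e^{2σ}(⟪W_k, q_k⟫ − ν̂(1+ε₀)^{2k}e^{-σ}‖W_k‖²)`: the damping `-W_k` is absorbed by
the weight and the dissipation appears with a sign (no cancellation property of the table is used).
[cite: Tao2016AveragedNS, §4, the viscous equation before Thm. 4.2 and Lemma 4.1 (4.8), shell-wise in the variables of §6.4; cell vocabulary] -/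
theorem hasDerivAt_expSq (hW : IsEternalVisc ε₀ νh α W) (k : ℤ) (σ : ℝ) :
    HasDerivAt (fun x => Real.exp (2 * x) * ‖W k x‖ ^ 2)
      (2 * Real.exp (2 * σ) * (⟪W k σ, quadPart ε₀ α W k σ⟫
        - νh * ((1 + ε₀) ^ ((2 : ℝ) * k) * Real.exp (-σ)) * ‖W k σ‖ ^ 2)) σ := by
  have hexp : HasDerivAt (fun x : ℝ => Real.exp (2 * x)) (2 * Real.exp (2 * σ)) σ := by
    have h := ((hasDerivAt_id σ).const_mul (2 : ℝ)).exp
    simp only [id, mul_one] at h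
    convert h using 1; ring
  have hsq := (hW.law k σ).norm_sq
  have hprod := hexp.mul hsq
  refine hprod.congr_deriv ?_
  -- the inner product of the state with the right-hand side of the law
  have hinner : ⟪W k σ, -((1 : ℝ) • W k σ) + tableQ α (W k σ) + bigLam ε₀ • tableA α (W (k - 1) σ)
        + (bigLam ε₀)⁻¹ • tableB α (W (k + 1) σ) (W k σ)
        - (νh * ((1 + ε₀) ^ ((2 : ℝ) * k) * Real.exp (-σ))) • W k σ⟫
      = -‖W k σ‖ ^ 2 + ⟪W k σ, quadPart ε₀ α W k σ⟫
        - νh * ((1 + ε₀) ^ ((2 : ℝ) * k) * Real.exp (-σ)) * ‖W k σ‖ ^ 2 := by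
    simp only [quadPart, inner_sub_right, inner_add_right, inner_neg_right, inner_smul_right, one_smul,
      real_inner_self_eq_norm_sq]
    ring
  rw [hinner]
  ring

/-- **One-sided bound.**  Under the uniform bound `‖W‖ ≤ D`: `φ_k'(σ) ≤ 2 e^{2σ} · K D³`
(`⟪W_k, q_k⟫ ≤ ‖W_k‖‖q_k‖ ≤ D · K D²`, dissipation dropped since `ν̂ ≥ 0`).
[cite: Tao2016AveragedNS, §4 Lemma 4.1 (4.8)–(4.10), §6.4; cell vocabulary] -/
theorem deriv_expSq_le (hε : 0 < ε₀) (hW : IsEternalVisc ε₀ νh α W) {D : ℝ}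
    (hD : ∀ (k : ℤ) (σ : ℝ), ‖W k σ‖ ≤ D) (k : ℤ) (σ : ℝ) :
    2 * Real.exp (2 * σ) * (⟪W k σ, quadPart ε₀ α W k σ⟫
        - νh * ((1 + ε₀) ^ ((2 : ℝ) * k) * Real.exp (-σ)) * ‖W k σ‖ ^ 2)
      ≤ 2 * Real.exp (2 * σ) * (quadConst ε₀ α * D ^ 3) := by
  have hD0 : 0 ≤ D := (norm_nonneg _).trans (hD 0 0)
  have hb : 0 < 1 + ε₀ := by linarith
  have hvisc : 0 ≤ νh * ((1 + ε₀) ^ ((2 : ℝ) * k) * Real.exp (-σ)) * ‖W k σ‖ ^ 2 :=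
    mul_nonneg (mul_nonneg hW.nonneg (mul_nonneg (Real.rpow_nonneg hb.le _) (Real.exp_pos _).le))
      (sq_nonneg _)
  have hin : ⟪W k σ, quadPart ε₀ α W k σ⟫ ≤ quadConst ε₀ α * D ^ 3 :=
    calc ⟪W k σ, quadPart ε₀ α W k σ⟫ ≤ ‖W k σ‖ * ‖quadPart ε₀ α W k σ‖ := real_inner_le_norm _ _
      _ ≤ D * (quadConst ε₀ α * D ^ 2) :=
          mul_le_mul (hD k σ) (norm_quadPart_le hε hD k σ) (norm_nonneg _) hD0
      _ = quadConst ε₀ α * D ^ 3 := by ring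
  have h2 : 0 ≤ 2 * Real.exp (2 * σ) := by positivity
  exact mul_le_mul_of_nonneg_left (by linarith) h2

/-! ## The squaring step in energy form -/

/-- **Squaring step (energy form).**  If `‖W_j(x)‖ ≤ D` for all shells and log-times, then
`‖W_k(σ)‖² ≤ K D³`: the function `e^{2x}‖W_k(x)‖² − K D³ e^{2x}` is antitone, and at the base point `a → -∞`
it is at most `e^{2a} D² → 0` (this is where ETERNITY and the uniform bound are used).
[cite: Tao2016AveragedNS, §4 Lemma 4.1 (4.8)–(4.10), §6.4; cell vocabulary] -/
theorem norm_sq_le_of_bound (hε : 0 < ε₀) (hW : IsEternalVisc ε₀ νh α W) {D : ℝ}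
    (hD : ∀ (k : ℤ) (σ : ℝ), ‖W k σ‖ ≤ D) (k : ℤ) (σ : ℝ) :
    ‖W k σ‖ ^ 2 ≤ quadConst ε₀ α * D ^ 3 := by
  set K := quadConst ε₀ α with hK
  have hD0 : 0 ≤ D := (norm_nonneg _).trans (hD 0 0)
  -- ψ(x) = e^{2x}‖W_k(x)‖² − K D³ e^{2x} is antitone
  set ψ : ℝ → ℝ := fun x => Real.exp (2 * x) * ‖W k x‖ ^ 2 - K * D ^ 3 * Real.exp (2 * x) with hψ
  have hexp : ∀ x : ℝ, HasDerivAt (fun y : ℝ => Real.exp (2 * y)) (2 * Real.exp (2 * x)) x := by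
    intro x
    have h := ((hasDerivAt_id x).const_mul (2 : ℝ)).exp
    simp only [id, mul_one] at h
    convert h using 1; ring
  have hψd : ∀ x, HasDerivAt ψ
      (2 * Real.exp (2 * x) * (⟪W k x, quadPart ε₀ α W k x⟫
        - νh * ((1 + ε₀) ^ ((2 : ℝ) * k) * Real.exp (-x)) * ‖W k x‖ ^ 2)
        - K * D ^ 3 * (2 * Real.exp (2 * x))) x :=
    fun x => (hasDerivAt_expSq hW k x).sub ((hexp x).const_mul (K * D ^ 3))
  have hanti : Antitone ψ := by
    refine antitone_of_deriv_nonpos (fun x => (hψd x).differentiableAt) fun x => ?_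
    rw [(hψd x).deriv]
    have := deriv_expSq_le hε hW hD k x
    linarith
  -- ψ(σ) ≤ ψ(a) ≤ e^{2a} D² for every a ≤ σ, and e^{2a} D² → 0 as a → -∞
  have hle : ∀ a : ℝ, a ≤ σ → ψ σ ≤ Real.exp (2 * a) * D ^ 2 := by
    intro a ha
    have h1 : ψ σ ≤ ψ a := hanti ha
    have h2 : ψ a ≤ Real.exp (2 * a) * ‖W k a‖ ^ 2 := by
      simp only [hψ]
      have : 0 ≤ K * D ^ 3 * Real.exp (2 * a) :=
        mul_nonneg (mul_nonneg (quadConst_nonneg hε α) (pow_nonneg hD0 3)) (Real.exp_pos _).le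
      linarith
    have h3 : Real.exp (2 * a) * ‖W k a‖ ^ 2 ≤ Real.exp (2 * a) * D ^ 2 :=
      mul_le_mul_of_nonneg_left (pow_le_pow_left₀ (norm_nonneg _) (hD k a) 2) (Real.exp_pos _).le
    linarith
  have hlim : Tendsto (fun a : ℝ => Real.exp (2 * a) * D ^ 2) atBot (𝓝 (0 * D ^ 2)) :=
    (Real.tendsto_exp_atBot.comp (tendsto_id.const_mul_atBot (by norm_num : (0 : ℝ) < 2))).mul_const _
  rw [zero_mul] at hlim
  have hψσ : ψ σ ≤ 0 :=
    ge_of_tendsto hlim (Filter.eventually_atBot.2 ⟨σ, fun a ha => hle a ha⟩)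
  -- divide by e^{2σ}
  have hpos : 0 < Real.exp (2 * σ) := Real.exp_pos _
  have h4 : Real.exp (2 * σ) * ‖W k σ‖ ^ 2 ≤ Real.exp (2 * σ) * (K * D ^ 3) := by
    simp only [hψ] at hψσ
    linarith
  exact le_of_mul_le_mul_left h4 hpos

/-! ## Small bounded viscous eternal solutions vanish; the amplitude quantum -/

/-- **Small-amplitude Liouville theorem with covariant viscosity.**  An admissible eternal solution of the
renormalised lattice with covariant viscosity `ν̂ ≥ 0` (any table of any size, any `ε₀ > 0`), with
`‖W_k(σ)‖ ≤ δ` everywhere and `K(α, ε₀) δ < 1`, is identically zero.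
[cite: Tao2016AveragedNS, §4, the viscous equation before Thm. 4.2, Lemma 4.1 (4.8)–(4.10), §6.4; cell vocabulary] -/
theorem eq_zero_of_small_visc (hε : 0 < ε₀) (hW : IsEternalVisc ε₀ νh α W) {δ : ℝ}
    (hδ : ∀ (k : ℤ) (σ : ℝ), ‖W k σ‖ ≤ δ) (hsmall : quadConst ε₀ α * δ < 1) :
    ∀ (k : ℤ) (σ : ℝ), W k σ = 0 := by
  set K := quadConst ε₀ α with hK
  have hK0 : 0 ≤ K := quadConst_nonneg hε α
  have hδ0 : 0 ≤ δ := (norm_nonneg _).trans (hδ 0 0)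
  have hθ0 : 0 ≤ K * δ := mul_nonneg hK0 hδ0
  -- the contraction ratio r = √(Kδ) < 1
  set r : ℝ := Real.sqrt (K * δ) with hr
  have hr0 : 0 ≤ r := Real.sqrt_nonneg _
  have hr1 : r < 1 := by
    rw [hr, show (1 : ℝ) = Real.sqrt 1 from Real.sqrt_one.symm]
    exact Real.sqrt_lt_sqrt hθ0 (by simpa using hsmall)
  have hrsq : r ^ 2 = K * δ := Real.sq_sqrt hθ0
  have iter : ∀ j : ℕ, ∀ (k : ℤ) (σ : ℝ), ‖W k σ‖ ≤ r ^ j * δ := by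
    intro j
    induction j with
    | zero => intro k σ; simpa using hδ k σ
    | succ j ih =>
        intro k σ
        have hDj0 : 0 ≤ r ^ j * δ := mul_nonneg (pow_nonneg hr0 _) hδ0
        have hDjle : r ^ j * δ ≤ δ := by
          have : r ^ j ≤ 1 := pow_le_one₀ hr0 hr1.le
          nlinarith
        have h1 := norm_sq_le_of_bound hε hW ih k σ
        -- ‖W‖² ≤ K D_j³ ≤ K δ D_j² = (r D_j)²
        have h2 : ‖W k σ‖ ^ 2 ≤ (r * (r ^ j * δ)) ^ 2 := by
          calc ‖W k σ‖ ^ 2 ≤ K * (r ^ j * δ) ^ 3 := h1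
            _ = K * (r ^ j * δ) * (r ^ j * δ) ^ 2 := by ring
            _ ≤ K * δ * (r ^ j * δ) ^ 2 :=
                mul_le_mul_of_nonneg_right (mul_le_mul_of_nonneg_left hDjle hK0) (sq_nonneg _)
            _ = (r * (r ^ j * δ)) ^ 2 := by rw [← hrsq]; ring
        have h3 : ‖W k σ‖ ≤ r * (r ^ j * δ) :=
          (pow_le_pow_iff_left₀ (norm_nonneg _) (mul_nonneg hr0 hDj0) two_ne_zero).1 h2
        calc ‖W k σ‖ ≤ r * (r ^ j * δ) := h3
          _ = r ^ (j + 1) * δ := by ring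
  intro k σ
  have hlim : Tendsto (fun j : ℕ => r ^ j * δ) atTop (𝓝 (0 * δ)) :=
    (tendsto_pow_atTop_nhds_zero_of_lt_one hr0 hr1).mul_const δ
  rw [zero_mul] at hlim
  have h0 : ‖W k σ‖ ≤ 0 := ge_of_tendsto' hlim fun j => iter j k σ
  exact norm_le_zero_iff.1 h0

/-- **The amplitude quantum (viscous).**  A non-zero uniformly bounded admissible eternal solution with
covariant viscosity `ν̂ ≥ 0` exceeds every level `δ` with `K δ < 1` somewhere: `sup_{k,σ} ‖W_k(σ)‖ ≥ 1/K(α, ε₀)`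
— scale-invariant (log-time translation rescales `ν̂`, not the sup-norm).
[cite: Tao2016AveragedNS, §4, the viscous equation before Thm. 4.2, §6.4; cell vocabulary] -/
theorem exists_norm_gt_of_ne_zero_visc (hε : 0 < ε₀) (hW : IsEternalVisc ε₀ νh α W)
    (hne : ∃ (k : ℤ) (σ : ℝ), W k σ ≠ 0) {δ : ℝ} (hsmall : quadConst ε₀ α * δ < 1) :
    ∃ (k : ℤ) (σ : ℝ), δ < ‖W k σ‖ := by
  by_contra! hcon
  obtain ⟨k, σ, hk⟩ := hne
  exact hk (eq_zero_of_small_visc hε hW hcon hsmall k σ)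

/-! ## The rung in K1ᵛ(1)'s quantifier shape -/

/-- The small-amplitude slice of the viscous Liouville predicate at EVERY survival exponent `a`, every
`ε₀ ∈ (0, 1]`, every spread and every `ν̂ ≥ 0`: an admissible eternal solution of an E₂(R) table with
sup-norm `≤ 1/1000` is not forward-surviving (it is zero; `quadConst ≤ 704` on E₂(R)).
[cite: Tao2016AveragedNS, §4 Thm. 4.2 (statement shape), Lemma 4.1 (4.8), §6.4; cell vocabulary] -/
theorem not_survivingFwd_of_small_visc {R a ε₀ νh : ℝ} {α : Fin 4 → Fin 4 → Fin 4 → ℤ × ℤ × ℤ → ℝ}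
    {W : ℤ → ℝ → Em 4} (hε : 0 < ε₀) (hε1 : ε₀ ≤ 1) (hα : InTableClass R α) (hW : IsEternalVisc ε₀ νh α W)
    (hsmall : ∀ (k : ℤ) (σ : ℝ), ‖W k σ‖ ≤ 1 / 1000) : ¬ EternalSurvivingFwd a ε₀ W := by
  have hK := quadConst_le hε hε1 hα
  have hlt : quadConst ε₀ α * (1 / 1000) < 1 := by
    have : quadConst ε₀ α * (1 / 1000) ≤ 704 * (1 / 1000) :=
      mul_le_mul_of_nonneg_right hK (by norm_num)
    linarith
  exact not_survivingFwd_of_eq_zero a ε₀ (eq_zero_of_small_visc hε hW hsmall hlt)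

/-- **K1ᵛ(1)-RUNG (small amplitude), PROVED** (threshold `εs = 1`, every spread `R`): below `ε₀ ≤ 1`, no
E₂(R) table carries an admissible eternal solution with covariant viscosity `ν̂ ≥ 0` of sup-norm `≤ 1/1000`
that is (S₁)-surviving forward.  Covers the (ρ0) slice (`ν̂ = 0`, the tree's inviscid rung) AND the (ρ+)
slice (`ν̂ > 0`, new) of the glued split at once.
[cite: Tao2016AveragedNS, §4 Thm. 4.2 (statement shape), Lemma 4.1 (4.8), §6.4; cell vocabulary] -/
theorem noSurvivingEternalViscBddOne_smallAmplitude :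
    ∀ R : ℝ, 1 ≤ R → ∃ εs : ℝ, 0 < εs ∧ ∀ ε₀ : ℝ, 0 < ε₀ → ε₀ ≤ εs →
      ∀ α : Fin 4 → Fin 4 → Fin 4 → ℤ × ℤ × ℤ → ℝ, InTableClass R α →
        ∀ (νh : ℝ) (W : ℤ → ℝ → Em 4), IsEternalVisc ε₀ νh α W →
          (∀ (k : ℤ) (σ : ℝ), ‖W k σ‖ ≤ 1 / 1000) → ¬ EternalSurvivingFwd 1 ε₀ W := by
  intro R _hR
  exact ⟨1, one_pos, fun ε₀ hε hε1 α hα νh W hW hsmall =>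
    not_survivingFwd_of_small_visc hε hε1 hα hW hsmall⟩

/-- The rung IS a case of the DECIDING crux K1ᵛ(1) `NoSurvivingEternalViscBddOne` (a sup-norm bound is a
`UniformBound`).
[cite: Tao2016AveragedNS, §4 Thm. 4.2 (statement shape), §6.4; cell vocabulary] -/
theorem smallAmplitude_of_noSurvivingEternalViscBddOne (h : NoSurvivingEternalViscBddOne) :
    ∀ R : ℝ, 1 ≤ R → ∃ εs : ℝ, 0 < εs ∧ ∀ ε₀ : ℝ, 0 < ε₀ → ε₀ ≤ εs →
      ∀ α : Fin 4 → Fin 4 → Fin 4 → ℤ × ℤ × ℤ → ℝ, InTableClass R α →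
        ∀ (νh : ℝ) (W : ℤ → ℝ → Em 4), IsEternalVisc ε₀ νh α W →
          (∀ (k : ℤ) (σ : ℝ), ‖W k σ‖ ≤ 1 / 1000) → ¬ EternalSurvivingFwd 1 ε₀ W := by
  intro R hR
  obtain ⟨εs, hεs, H⟩ := h R hR
  exact ⟨εs, hεs, fun ε₀ hε hle α hα νh W hW hsmall => H ε₀ hε hle α hα νh W hW ⟨1 / 1000, hsmall⟩⟩

/-- **Amplitude floor for the objects K1ᵛ(1) must exclude.**  On an E₂(R) table with `ε₀ ∈ (0,1]`, every
forward-(S₁)-surviving admissible eternal solution with covariant viscosity `ν̂ ≥ 0` (in particular every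
loud ladder of (ρ+) and every surviving front of (ρ0)) has a shell and a log-time with `‖W_k(σ)‖ > 1/1000`.
[cite: Tao2016AveragedNS, §4 Thm. 4.2 (statement shape), §6.4; cell vocabulary] -/
theorem exists_norm_gt_of_survivingFwd {R a ε₀ νh : ℝ} {α : Fin 4 → Fin 4 → Fin 4 → ℤ × ℤ × ℤ → ℝ}
    {W : ℤ → ℝ → Em 4} (hε : 0 < ε₀) (hε1 : ε₀ ≤ 1) (hα : InTableClass R α) (hW : IsEternalVisc ε₀ νh α W)
    (hS : EternalSurvivingFwd a ε₀ W) : ∃ (k : ℤ) (σ : ℝ), 1 / 1000 < ‖W k σ‖ := by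
  by_contra! hcon
  exact not_survivingFwd_of_small_visc hε hε1 hα hW hcon hS

end Summit.NavierStokesRegularity.NavierStokesRegularity.Theorems.NoSurvivingEternalViscBddOne.SmallAmplitude

end
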